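import Summits.CriticalPhenomena.PercolationContinuityZ3.Theorems.PercNearOneGluingAdditiveGluingFibreEdgeSurgery
import HarnessLib

/-!
# Crux `PercNearOneGluing.AdditiveGluing` (stmt-CriticalPhenomena-4576), line `tieline`:
# the contraction step of the fibre count (T) is an EXACT identity — the (CM3)-v increment is an explicit signed count

Support file (`--supports stmt-CriticalPhenomena-4576`, helper, seat (d) exchange-certificate form, gen 8).  No named facts,
no sorries; the only definitions are the explicit summands `seedSummand`, `tagSummand`, `tagSummandDuo`.

`…FibreContraction` reduces the kernel (T) to (CM3)-v: `fibreSumT o b u v c (I[e ↦ 3]) ≤ fibreSumT o b u v c I` for a random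
edge `e = s(x, y)` with `x` in the `3`-component of `v` (0 violations in ttrl2's exhaustive census through `n = 7`; the u-side
analogue is refuted in `…FibreContractionUFalse`).  Here we prove that the increment is ITSELF a signed fibre count on the count
vector `I[e ↦ 0]` with an explicit summand (memo EXCHCERT-g8 §2.1).  Writing `K_k, L_k, M₁` for the clusters of `u`, `v`, `c` in
replica `k`, `τ` for the summand of (T) (`summandT`) and `σ` for the same summand with `v`'s replica-3 cluster replaced by the
replica-3 cluster of the SET `{v, y}` (`seedSummand`: "`y` becomes a conditional replica-3 seed of `v`"):

  solo edge (`I e = 1`):  `fibreSumT I = fibreSumT (I[e ↦ 3]) + fibreSumF (([y ∉ M₁] + [y ∉ K₂])·τ + [y ∈ M₁ ∪ K₂]·σ) (I[e ↦ 0])`,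
  duo edge  (`I e = 2`):  `fibreSumT I = fibreSumT (I[e ↦ 3]) + fibreSumF ([y ∉ M₁][y ∉ K₂]·τ + [¬(y ∈ M₁ ∩ K₂)]·σ) (I[e ↦ 0])`

(`fibreSumT_soloStep`, `fibreSumT_duoStep`).  The proof is pointwise on the fibre of `I[e ↦ 0]`: opening `e` in replica `k`
only changes reachability from `v` (by the cluster of `y`), because on the support of the summand the other named clusters avoid
both endpoints of `e` (`rep1_open`, `rep2_open`, `rep3_open`).  Consequences: (CM3)-v at `e` is EQUIVALENT to the nonnegativity of
the tagged count (`contractionMonotone_iff_solo/duo`), and the kernel's fibre counts are nonnegative as soon as all tagged counts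
are (`fibreSumT_nonneg_of_tag_nonneg`, feeding `fibreSumT_nonneg_of_contractionMonotone`).  The same computation iterates
(memo §2.1: a closed recursion in the family of tagged counts); only the first step is formalised here.
[folklore] (one-edge surgery on open paths; linear recombination of indicator products)
-/

namespace Summit.CriticalPhenomena.PercolationContinuityZ3.Cruxes.AdditiveGluing.TieLine.FibreCount

open MeasureTheory Set Finset Literature.Probability.Percolation

open Classical

/-! ### The pointwise identity: opening the edge `e = s(x, y)` at the core of `v` -/

section Pointwise

variable {n : ℕ}

/-- Opening a coordinate of a Boolean edge vector inserts the edge. [folklore] -/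
theorem cfg_update_true (a : Sym2 (Fin n) → Bool) (e : Sym2 (Fin n)) : cfg (Function.update a e true) = insert e (cfg a) := by
  ext i
  by_cases h : i = e
  · subst h; simp [cfg]
  · simp [cfg, Set.mem_insert_iff, h]

/-- Re-setting a closed coordinate to `false` does nothing. [folklore] -/
theorem update_false_of_eq {a : Sym2 (Fin n) → Bool} {e : Sym2 (Fin n)} (h : a e = false) : Function.update a e false = a := by
  rw [← h]; exact Function.update_eq_self e a

/-- The seed summand: the summand of (T) in which the replica-3 cluster of `v` is replaced by the replica-3 cluster of the
set `{v, y}` (in the avoidance of `u` and in the targets `o`, `c`). [folklore] -/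
noncomputable def seedSummand (o b u v c y : Fin n) (t : Triple (Sym2 (Fin n))) : ℝ :=
  (1 - rch t.1 c u) * (1 - rch t.1 c v) * (1 - rch t.2.1 u v) *
    (1 - ir ((openGraph (cfg t.2.2)).Reachable u v ∨ (openGraph (cfg t.2.2)).Reachable u y)) *
    (rch t.2.1 u b - rch t.2.2 u b) *
    (ir ((openGraph (cfg t.2.2)).Reachable v o ∨ (openGraph (cfg t.2.2)).Reachable y o) -
      rch t.1 o c * ir ((openGraph (cfg t.2.2)).Reachable v c ∨ (openGraph (cfg t.2.2)).Reachable y c))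

/-- The tagged summand of one solo contraction step at `y`:
`([y ∉ M₁] + [y ∉ K₂]) · τ + [y ∈ M₁ ∪ K₂] · σ` (memo EXCHCERT-g8 §2.1). [folklore] -/
noncomputable def tagSummand (o b u v c y : Fin n) (t : Triple (Sym2 (Fin n))) : ℝ :=
  ((1 - rch t.1 c y) + (1 - rch t.2.1 u y)) * summandT o b u v c t +
    (1 - (1 - rch t.1 c y) * (1 - rch t.2.1 u y)) * seedSummand o b u v c y t

/-- The tagged summand of one duo contraction step at `y`: `[y ∉ M₁][y ∉ K₂] · τ + [¬(y ∈ M₁ ∩ K₂)] · σ`. [folklore] -/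
noncomputable def tagSummandDuo (o b u v c y : Fin n) (t : Triple (Sym2 (Fin n))) : ℝ :=
  (1 - rch t.1 c y) * (1 - rch t.2.1 u y) * summandT o b u v c t +
    (1 - rch t.1 c y * rch t.2.1 u y) * seedSummand o b u v c y t

variable (o b u v c x y : Fin n) (t : Triple (Sym2 (Fin n)))

/-- Replica 1 opened at `e = s(x,y)` (`x` in `v`'s cluster): the factor `[c ↮ u][c ↮ v]` picks up `[c ↮ y]`, and on its support
`[o ↔ c]` is unchanged. [folklore] -/
theorem rep1_open (a : Sym2 (Fin n) → Bool) (hvx : (openGraph (cfg a)).Reachable v x) (Q R : ℝ) :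
    (1 - rch (Function.update a s(x, y) true) c u) * (1 - rch (Function.update a s(x, y) true) c v) *
        (Q - rch (Function.update a s(x, y) true) o c * R) =
      (1 - rch a c y) * ((1 - rch a c u) * (1 - rch a c v) * (Q - rch a o c * R)) := by
  unfold rch
  rw [cfg_update_true]
  set ω := cfg a
  by_cases hcv : (openGraph ω).Reachable c v
  · have hcv' : (openGraph (insert s(x, y) ω)).Reachable c v := reachable_insert_of_reachable hcv
    rw [ir_of_true hcv, ir_of_true hcv']; ring
  · by_cases hcy : (openGraph ω).Reachable c y
    · have hcv' : (openGraph (insert s(x, y) ω)).Reachable c v :=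
        ((reachable_insert_of_reachable hcy).trans (reachable_insert_endpoints ω x y).symm).trans
          (reachable_insert_of_reachable hvx.symm)
      rw [ir_of_true hcy, ir_of_true hcv']; ring
    · have hcx : ¬ (openGraph ω).Reachable c x := fun h => hcv (h.trans hvx.symm)
      have hcv' : ¬ (openGraph (insert s(x, y) ω)).Reachable c v := by
        rw [reachable_insert_iff_of_not_reachable hcx hcy]; exact hcv
      have hcu' : (openGraph (insert s(x, y) ω)).Reachable c u ↔ (openGraph ω).Reachable c u :=
        reachable_insert_iff_of_not_reachable hcx hcy u
      have hoc' : (openGraph (insert s(x, y) ω)).Reachable o c ↔ (openGraph ω).Reachable o c := by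
        rw [SimpleGraph.reachable_comm, reachable_insert_iff_of_not_reachable hcx hcy o, SimpleGraph.reachable_comm]
      rw [ir_of_false hcv, ir_of_false hcv', ir_of_false hcy, ir_congr hcu', ir_congr hoc']; ring

/-- Replica 2 opened at `e`: the factor `[u ↮ v]` picks up `[u ↮ y]`, and on its support `[u ↔ b]` is unchanged. [folklore] -/
theorem rep2_open (a : Sym2 (Fin n) → Bool) (hvx : (openGraph (cfg a)).Reachable v x) (Q : ℝ) :
    (1 - rch (Function.update a s(x, y) true) u v) * (rch (Function.update a s(x, y) true) u b - Q) =
      (1 - rch a u y) * ((1 - rch a u v) * (rch a u b - Q)) := by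
  unfold rch
  rw [cfg_update_true]
  set ω := cfg a
  by_cases huv : (openGraph ω).Reachable u v
  · have huv' : (openGraph (insert s(x, y) ω)).Reachable u v := reachable_insert_of_reachable huv
    rw [ir_of_true huv, ir_of_true huv']; ring
  · by_cases huy : (openGraph ω).Reachable u y
    · have huv' : (openGraph (insert s(x, y) ω)).Reachable u v :=
        ((reachable_insert_of_reachable huy).trans (reachable_insert_endpoints ω x y).symm).trans
          (reachable_insert_of_reachable hvx.symm)
      rw [ir_of_true huy, ir_of_true huv']; ring
    · have hux : ¬ (openGraph ω).Reachable u x := fun h => huv (h.trans hvx.symm)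
      have huv' : ¬ (openGraph (insert s(x, y) ω)).Reachable u v := by
        rw [reachable_insert_iff_of_not_reachable hux huy]; exact huv
      have hub' : (openGraph (insert s(x, y) ω)).Reachable u b ↔ (openGraph ω).Reachable u b :=
        reachable_insert_iff_of_not_reachable hux huy b
      rw [ir_of_false huv, ir_of_false huv', ir_of_false huy, ir_congr hub']; ring

/-- Replica 3 opened at `e`: `v`'s cluster becomes the cluster of `{v, y}`; on the support of `[u ↮ {v,y}]`, `[u ↔ b]` is
unchanged. [folklore] -/
theorem rep3_open (a : Sym2 (Fin n) → Bool) (hvx : (openGraph (cfg a)).Reachable v x) (P Q : ℝ) :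
    (1 - rch (Function.update a s(x, y) true) u v) * (P - rch (Function.update a s(x, y) true) u b) *
        (rch (Function.update a s(x, y) true) v o - Q * rch (Function.update a s(x, y) true) v c) =
      (1 - ir ((openGraph (cfg a)).Reachable u v ∨ (openGraph (cfg a)).Reachable u y)) * (P - rch a u b) *
        (ir ((openGraph (cfg a)).Reachable v o ∨ (openGraph (cfg a)).Reachable y o) -
          Q * ir ((openGraph (cfg a)).Reachable v c ∨ (openGraph (cfg a)).Reachable y c)) := by
  unfold rch
  rw [cfg_update_true]
  set ω := cfg a
  have hvo : (openGraph (insert s(x, y) ω)).Reachable v o ↔ (openGraph ω).Reachable v o ∨ (openGraph ω).Reachable y o :=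
    reachable_insert_iff_of_reachable hvx o
  have hvc : (openGraph (insert s(x, y) ω)).Reachable v c ↔ (openGraph ω).Reachable v c ∨ (openGraph ω).Reachable y c :=
    reachable_insert_iff_of_reachable hvx c
  have huv : (openGraph (insert s(x, y) ω)).Reachable u v ↔ (openGraph ω).Reachable u v ∨ (openGraph ω).Reachable u y := by
    rw [SimpleGraph.reachable_comm, reachable_insert_iff_of_reachable hvx u, SimpleGraph.reachable_comm,
      @SimpleGraph.reachable_comm _ _ y u]
  rw [ir_congr hvo, ir_congr hvc, ir_congr huv]
  by_cases h : (openGraph ω).Reachable u v ∨ (openGraph ω).Reachable u y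
  · rw [ir_of_true h]; ring
  · have hux : ¬ (openGraph ω).Reachable u x := fun h' => h (Or.inl (h'.trans hvx.symm))
    have huy : ¬ (openGraph ω).Reachable u y := fun h' => h (Or.inr h')
    have hub' : (openGraph (insert s(x, y) ω)).Reachable u b ↔ (openGraph ω).Reachable u b :=
      reachable_insert_iff_of_not_reachable hux huy b
    rw [ir_congr hub']

variable {o b u v c x y t}

/-- `e` opened in replica 1 only. [folklore] -/
theorem summandT_open100 (h2 : t.2.1 s(x, y) = false) (h3 : t.2.2 s(x, y) = false)
    (hvx₁ : (openGraph (cfg t.1)).Reachable v x) :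
    summandT o b u v c (setAt s(x, y) true false false t) = (1 - rch t.1 c y) * summandT o b u v c t := by
  unfold summandT
  simp only [setAt_fst, setAt_snd_fst, setAt_snd_snd, update_false_of_eq h2, update_false_of_eq h3]
  have H := rep1_open o u v c x y t.1 hvx₁ (rch t.2.2 v o) (rch t.2.2 v c)
  linear_combination ((1 - rch t.2.1 u v) * (1 - rch t.2.2 u v) * (rch t.2.1 u b - rch t.2.2 u b)) * H

/-- `e` opened in replica 2 only. [folklore] -/
theorem summandT_open010 (h1 : t.1 s(x, y) = false) (h3 : t.2.2 s(x, y) = false)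
    (hvx₂ : (openGraph (cfg t.2.1)).Reachable v x) :
    summandT o b u v c (setAt s(x, y) false true false t) = (1 - rch t.2.1 u y) * summandT o b u v c t := by
  unfold summandT
  simp only [setAt_fst, setAt_snd_fst, setAt_snd_snd, update_false_of_eq h1, update_false_of_eq h3]
  have H := rep2_open b u v x y t.2.1 hvx₂ (rch t.2.2 u b)
  linear_combination ((1 - rch t.1 c u) * (1 - rch t.1 c v) * (1 - rch t.2.2 u v) *
    (rch t.2.2 v o - rch t.1 o c * rch t.2.2 v c)) * H

/-- `e` opened in replica 3 only: the seed summand. [folklore] -/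
theorem summandT_open001 (h1 : t.1 s(x, y) = false) (h2 : t.2.1 s(x, y) = false)
    (hvx₃ : (openGraph (cfg t.2.2)).Reachable v x) :
    summandT o b u v c (setAt s(x, y) false false true t) = seedSummand o b u v c y t := by
  unfold summandT seedSummand
  simp only [setAt_fst, setAt_snd_fst, setAt_snd_snd, update_false_of_eq h1, update_false_of_eq h2]
  have H := rep3_open o b u v c x y t.2.2 hvx₃ (rch t.2.1 u b) (rch t.1 o c)
  linear_combination ((1 - rch t.1 c u) * (1 - rch t.1 c v) * (1 - rch t.2.1 u v)) * H

/-- `e` opened in all three replicas (contracted). [folklore] -/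
theorem summandT_open111 (hvx₁ : (openGraph (cfg t.1)).Reachable v x) (hvx₂ : (openGraph (cfg t.2.1)).Reachable v x)
    (hvx₃ : (openGraph (cfg t.2.2)).Reachable v x) :
    summandT o b u v c (setAt s(x, y) true true true t) =
      (1 - rch t.1 c y) * (1 - rch t.2.1 u y) * seedSummand o b u v c y t := by
  unfold summandT seedSummand
  simp only [setAt_fst, setAt_snd_fst, setAt_snd_snd]
  have H1 := rep1_open o u v c x y t.1 hvx₁
  have H2 := rep2_open b u v x y t.2.1 hvx₂
  have H3 := rep3_open o b u v c x y t.2.2 hvx₃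
  -- abbreviate the primed atoms
  set cu' := rch (Function.update t.1 s(x, y) true) c u
  set cv' := rch (Function.update t.1 s(x, y) true) c v
  set oc' := rch (Function.update t.1 s(x, y) true) o c
  set uv2' := rch (Function.update t.2.1 s(x, y) true) u v
  set ub2' := rch (Function.update t.2.1 s(x, y) true) u b
  set uv3' := rch (Function.update t.2.2 s(x, y) true) u v
  set ub3' := rch (Function.update t.2.2 s(x, y) true) u b
  set vo3' := rch (Function.update t.2.2 s(x, y) true) v o
  set vc3' := rch (Function.update t.2.2 s(x, y) true) v c
  set UVY := ir ((openGraph (cfg t.2.2)).Reachable u v ∨ (openGraph (cfg t.2.2)).Reachable u y)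
  set VO := ir ((openGraph (cfg t.2.2)).Reachable v o ∨ (openGraph (cfg t.2.2)).Reachable y o)
  set VC := ir ((openGraph (cfg t.2.2)).Reachable v c ∨ (openGraph (cfg t.2.2)).Reachable y c)
  -- replica 3 first (P := ub2', Q := oc'), then replica 2 (Q := ub₃), then replica 1 (Q := VO, R := VC)
  have E3 := H3 ub2' oc'
  have E2 := H2 (rch t.2.2 u b)
  have E1 := H1 VO VC
  linear_combination ((1 - cu') * (1 - cv') * (1 - uv2')) * E3 +
    ((1 - cu') * (1 - cv') * (1 - UVY) * (VO - oc' * VC)) * E2 +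
    ((1 - UVY) * (1 - rch t.2.1 u y) * (1 - rch t.2.1 u v) * (rch t.2.1 u b - rch t.2.2 u b)) * E1

/-- `e` opened in replicas 1 and 2. [folklore] -/
theorem summandT_open110 (h3 : t.2.2 s(x, y) = false) (hvx₁ : (openGraph (cfg t.1)).Reachable v x)
    (hvx₂ : (openGraph (cfg t.2.1)).Reachable v x) :
    summandT o b u v c (setAt s(x, y) true true false t) =
      (1 - rch t.1 c y) * (1 - rch t.2.1 u y) * summandT o b u v c t := by
  unfold summandT
  simp only [setAt_fst, setAt_snd_fst, setAt_snd_snd, update_false_of_eq h3]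
  have H1 := rep1_open o u v c x y t.1 hvx₁
  have H2 := rep2_open b u v x y t.2.1 hvx₂
  set cu' := rch (Function.update t.1 s(x, y) true) c u
  set cv' := rch (Function.update t.1 s(x, y) true) c v
  set oc' := rch (Function.update t.1 s(x, y) true) o c
  set uv2' := rch (Function.update t.2.1 s(x, y) true) u v
  set ub2' := rch (Function.update t.2.1 s(x, y) true) u b
  have E2 := H2 (rch t.2.2 u b)
  have E1 := H1 (rch t.2.2 v o) (rch t.2.2 v c)
  linear_combination ((1 - cu') * (1 - cv') * (1 - rch t.2.2 u v) * (rch t.2.2 v o - oc' * rch t.2.2 v c)) * E2 +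
    ((1 - rch t.2.2 u v) * (1 - rch t.2.1 u y) * (1 - rch t.2.1 u v) * (rch t.2.1 u b - rch t.2.2 u b)) * E1

/-- `e` opened in replicas 1 and 3. [folklore] -/
theorem summandT_open101 (h2 : t.2.1 s(x, y) = false) (hvx₁ : (openGraph (cfg t.1)).Reachable v x)
    (hvx₃ : (openGraph (cfg t.2.2)).Reachable v x) :
    summandT o b u v c (setAt s(x, y) true false true t) = (1 - rch t.1 c y) * seedSummand o b u v c y t := by
  unfold summandT seedSummand
  simp only [setAt_fst, setAt_snd_fst, setAt_snd_snd, update_false_of_eq h2]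
  have H1 := rep1_open o u v c x y t.1 hvx₁
  have H3 := rep3_open o b u v c x y t.2.2 hvx₃
  set cu' := rch (Function.update t.1 s(x, y) true) c u
  set cv' := rch (Function.update t.1 s(x, y) true) c v
  set oc' := rch (Function.update t.1 s(x, y) true) o c
  set uv3' := rch (Function.update t.2.2 s(x, y) true) u v
  set ub3' := rch (Function.update t.2.2 s(x, y) true) u b
  set vo3' := rch (Function.update t.2.2 s(x, y) true) v o
  set vc3' := rch (Function.update t.2.2 s(x, y) true) v c
  set UVY := ir ((openGraph (cfg t.2.2)).Reachable u v ∨ (openGraph (cfg t.2.2)).Reachable u y)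
  set VO := ir ((openGraph (cfg t.2.2)).Reachable v o ∨ (openGraph (cfg t.2.2)).Reachable y o)
  set VC := ir ((openGraph (cfg t.2.2)).Reachable v c ∨ (openGraph (cfg t.2.2)).Reachable y c)
  have E3 := H3 (rch t.2.1 u b) oc'
  have E1 := H1 VO VC
  linear_combination ((1 - cu') * (1 - cv') * (1 - rch t.2.1 u v)) * E3 +
    ((1 - rch t.2.1 u v) * (1 - UVY) * (rch t.2.1 u b - rch t.2.2 u b)) * E1

/-- `e` opened in replicas 2 and 3. [folklore] -/
theorem summandT_open011 (h1 : t.1 s(x, y) = false) (hvx₂ : (openGraph (cfg t.2.1)).Reachable v x)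
    (hvx₃ : (openGraph (cfg t.2.2)).Reachable v x) :
    summandT o b u v c (setAt s(x, y) false true true t) = (1 - rch t.2.1 u y) * seedSummand o b u v c y t := by
  unfold summandT seedSummand
  simp only [setAt_fst, setAt_snd_fst, setAt_snd_snd, update_false_of_eq h1]
  have H2 := rep2_open b u v x y t.2.1 hvx₂
  have H3 := rep3_open o b u v c x y t.2.2 hvx₃
  set uv2' := rch (Function.update t.2.1 s(x, y) true) u v
  set ub2' := rch (Function.update t.2.1 s(x, y) true) u b
  set uv3' := rch (Function.update t.2.2 s(x, y) true) u v
  set ub3' := rch (Function.update t.2.2 s(x, y) true) u b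
  set vo3' := rch (Function.update t.2.2 s(x, y) true) v o
  set vc3' := rch (Function.update t.2.2 s(x, y) true) v c
  set UVY := ir ((openGraph (cfg t.2.2)).Reachable u v ∨ (openGraph (cfg t.2.2)).Reachable u y)
  set VO := ir ((openGraph (cfg t.2.2)).Reachable v o ∨ (openGraph (cfg t.2.2)).Reachable y o)
  set VC := ir ((openGraph (cfg t.2.2)).Reachable v c ∨ (openGraph (cfg t.2.2)).Reachable y c)
  have E3 := H3 ub2' (rch t.1 o c)
  have E2 := H2 (rch t.2.2 u b)
  linear_combination ((1 - rch t.1 c u) * (1 - rch t.1 c v) * (1 - uv2')) * E3 +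
    ((1 - rch t.1 c u) * (1 - rch t.1 c v) * (1 - UVY) * (VO - rch t.1 o c * VC)) * E2

/-- **The pointwise identity, solo edge.**  On the fibre of `I[e ↦ 0]` (all replicas closed at `e`), with `x` joined to `v` in
every replica: opening `e` in exactly one replica, summed over the three replicas, minus opening it in all three, equals the
tagged summand. [folklore] -/
theorem summandT_soloStep (h1 : t.1 s(x, y) = false) (h2 : t.2.1 s(x, y) = false) (h3 : t.2.2 s(x, y) = false)
    (hvx₁ : (openGraph (cfg t.1)).Reachable v x) (hvx₂ : (openGraph (cfg t.2.1)).Reachable v x)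
    (hvx₃ : (openGraph (cfg t.2.2)).Reachable v x) :
    summandT o b u v c (setAt s(x, y) true false false t) + summandT o b u v c (setAt s(x, y) false true false t) +
        summandT o b u v c (setAt s(x, y) false false true t) =
      summandT o b u v c (setAt s(x, y) true true true t) + tagSummand o b u v c y t := by
  rw [summandT_open100 h2 h3 hvx₁, summandT_open010 h1 h3 hvx₂, summandT_open001 h1 h2 hvx₃,
    summandT_open111 hvx₁ hvx₂ hvx₃]
  unfold tagSummand
  ring

/-- **The pointwise identity, duo edge.** [folklore] -/
theorem summandT_duoStep (h1 : t.1 s(x, y) = false) (h2 : t.2.1 s(x, y) = false) (h3 : t.2.2 s(x, y) = false)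
    (hvx₁ : (openGraph (cfg t.1)).Reachable v x) (hvx₂ : (openGraph (cfg t.2.1)).Reachable v x)
    (hvx₃ : (openGraph (cfg t.2.2)).Reachable v x) :
    summandT o b u v c (setAt s(x, y) true true false t) + summandT o b u v c (setAt s(x, y) true false true t) +
        summandT o b u v c (setAt s(x, y) false true true t) =
      summandT o b u v c (setAt s(x, y) true true true t) + tagSummandDuo o b u v c y t := by
  rw [summandT_open110 h3 hvx₁ hvx₂, summandT_open101 h2 hvx₁ hvx₃, summandT_open011 h1 hvx₂ hvx₃,
    summandT_open111 hvx₁ hvx₂ hvx₃]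
  unfold tagSummandDuo
  ring

end Pointwise

/-! ### The contraction step of (T)'s fibre count is an exact identity -/

section Step

variable {n : ℕ}

/-- On the fibre of `I[e ↦ 0]`, a vertex `3`-reachable from `v` for `I` (with `I e ≠ 3`) is reachable from `v` in every
replica. [folklore] -/
theorem reach_replicas_of_three {I : Sym2 (Fin n) → ℕ} {e : Sym2 (Fin n)} (he : I e ≠ 3) {v x : Fin n}
    (hx : (openGraph {f | I f = 3}).Reachable v x) {t : Triple (Sym2 (Fin n))} (ht : cnt t = Function.update I e 0) :
    (openGraph (cfg t.1)).Reachable v x ∧ (openGraph (cfg t.2.1)).Reachable v x ∧ (openGraph (cfg t.2.2)).Reachable v x := by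
  have hsub : ∀ k : Set (Sym2 (Fin n)), (k = cfg t.1 ∨ k = cfg t.2.1 ∨ k = cfg t.2.2) → {f | I f = 3} ⊆ k := by
    intro k hk f hf
    have hf3 : Function.update I e 0 f = 3 := by
      have hfe : f ≠ e := fun h => he (h ▸ hf)
      rw [Function.update_of_ne hfe]; exact hf
    obtain ⟨a1, a2, a3⟩ := open_of_cnt_eq_three ht hf3
    rcases hk with rfl | rfl | rfl
    · exact a1
    · exact a2
    · exact a3
  exact ⟨hx.mono (BHK2006.openGraph_le (hsub _ (Or.inl rfl))), hx.mono (BHK2006.openGraph_le (hsub _ (Or.inr (Or.inl rfl)))),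
    hx.mono (BHK2006.openGraph_le (hsub _ (Or.inr (Or.inr rfl))))⟩

/-- **Solo contraction step (exact).**  For a count vector `I`, a solo edge `e = s(x, y)` (`I e = 1`) with `x` in the
`3`-component of `v`:  `fibreSumT I = fibreSumT (I[e ↦ 3]) + fibreSumF (tagSummand o b u v c y) (I[e ↦ 0])`.
In particular the (CM3)-v increment is the explicit signed count `fibreSumF (tagSummand …) (I[e ↦ 0])`. [folklore] -/
theorem fibreSumT_soloStep (o b u v c : Fin n) (I : Sym2 (Fin n) → ℕ) (x y : Fin n) (he : I s(x, y) = 1)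
    (hx : (openGraph {f | I f = 3}).Reachable v x) :
    fibreSumT o b u v c I = fibreSumT o b u v c (Function.update I s(x, y) 3) +
      fibreSumF (tagSummand o b u v c y) (Function.update I s(x, y) 0) := by
  rw [fibreSumT_eq_fibreSumF, fibreSumT_eq_fibreSumF, fibreSumF_split_one _ I s(x, y) he,
    fibreSumF_split_three _ (Function.update I s(x, y) 3) s(x, y) (Function.update_self _ _ _), Function.update_idem,
    ← fibreSumF_add, ← fibreSumF_add, ← fibreSumF_add]
  refine fibreSumF_congr fun t ht => ?_
  obtain ⟨h1, h2, h3⟩ := apply_eq_false_of_cnt_eq_zero (t := t) (e := s(x, y)) (by rw [ht, Function.update_self])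
  obtain ⟨hv1, hv2, hv3⟩ := reach_replicas_of_three (by rw [he]; decide) hx ht
  exact summandT_soloStep h1 h2 h3 hv1 hv2 hv3

/-- **Duo contraction step (exact).**  Same for a duo edge (`I e = 2`) with the duo tagged summand. [folklore] -/
theorem fibreSumT_duoStep (o b u v c : Fin n) (I : Sym2 (Fin n) → ℕ) (x y : Fin n) (he : I s(x, y) = 2)
    (hx : (openGraph {f | I f = 3}).Reachable v x) :
    fibreSumT o b u v c I = fibreSumT o b u v c (Function.update I s(x, y) 3) +
      fibreSumF (tagSummandDuo o b u v c y) (Function.update I s(x, y) 0) := by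
  rw [fibreSumT_eq_fibreSumF, fibreSumT_eq_fibreSumF, fibreSumF_split_two _ I s(x, y) he,
    fibreSumF_split_three _ (Function.update I s(x, y) 3) s(x, y) (Function.update_self _ _ _), Function.update_idem,
    ← fibreSumF_add, ← fibreSumF_add, ← fibreSumF_add]
  refine fibreSumF_congr fun t ht => ?_
  obtain ⟨h1, h2, h3⟩ := apply_eq_false_of_cnt_eq_zero (t := t) (e := s(x, y)) (by rw [ht, Function.update_self])
  obtain ⟨hv1, hv2, hv3⟩ := reach_replicas_of_three (by rw [he]; decide) hx ht
  exact summandT_duoStep h1 h2 h3 hv1 hv2 hv3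

/-- **(CM3)-v at a solo edge is the nonnegativity of an explicit count.** [folklore] -/
theorem contractionMonotone_iff_solo (o b u v c : Fin n) (I : Sym2 (Fin n) → ℕ) (x y : Fin n) (he : I s(x, y) = 1)
    (hx : (openGraph {f | I f = 3}).Reachable v x) :
    fibreSumT o b u v c (Function.update I s(x, y) 3) ≤ fibreSumT o b u v c I ↔
      0 ≤ fibreSumF (tagSummand o b u v c y) (Function.update I s(x, y) 0) := by
  rw [fibreSumT_soloStep o b u v c I x y he hx]
  constructor <;> intro h <;> linarith

/-- **(CM3)-v at a duo edge is the nonnegativity of an explicit count.** [folklore] -/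
theorem contractionMonotone_iff_duo (o b u v c : Fin n) (I : Sym2 (Fin n) → ℕ) (x y : Fin n) (he : I s(x, y) = 2)
    (hx : (openGraph {f | I f = 3}).Reachable v x) :
    fibreSumT o b u v c (Function.update I s(x, y) 3) ≤ fibreSumT o b u v c I ↔
      0 ≤ fibreSumF (tagSummandDuo o b u v c y) (Function.update I s(x, y) 0) := by
  rw [fibreSumT_duoStep o b u v c I x y he hx]
  constructor <;> intro h <;> linarith

/-- **The kernel (T) from the tagged counts.**  If for every count vector and every random edge `s(x, z)` at the boundary of the
`3`-component of `v` the tagged count (solo or duo, as the case may be) on `I[e ↦ 0]` is nonnegative, then every fibre count of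
(T) at the roles `o b u v c` is nonnegative (hence (T) at these roles for all weights, by `covTransferQ_of_fibres`). [folklore] -/
theorem fibreSumT_nonneg_of_tag_nonneg (o b u v c : Fin n)
    (hsolo : ∀ I : Sym2 (Fin n) → ℕ, ∀ x z : Fin n, (openGraph {e | I e = 3}).Reachable v x →
      ¬ (openGraph {e | I e = 3}).Reachable v z → ¬ (openGraph {e | I e = 3}).Reachable u z → I s(x, z) = 1 →
      0 ≤ fibreSumF (tagSummand o b u v c z) (Function.update I s(x, z) 0))
    (hduo : ∀ I : Sym2 (Fin n) → ℕ, ∀ x z : Fin n, (openGraph {e | I e = 3}).Reachable v x →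
      ¬ (openGraph {e | I e = 3}).Reachable v z → ¬ (openGraph {e | I e = 3}).Reachable u z → I s(x, z) = 2 →
      0 ≤ fibreSumF (tagSummandDuo o b u v c z) (Function.update I s(x, z) 0))
    (I : Sym2 (Fin n) → ℕ) : 0 ≤ fibreSumT o b u v c I := by
  refine fibreSumT_nonneg_of_contractionMonotone o b u v c (fun J x z hx hz huz hJ => ?_) I
  rcases hJ with hJ | hJ
  · exact (contractionMonotone_iff_solo o b u v c J x z hJ hx).2 (hsolo J x z hx hz huz hJ)
  · exact (contractionMonotone_iff_duo o b u v c J x z hJ hx).2 (hduo J x z hx hz huz hJ)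

end Step

end Summit.CriticalPhenomena.PercolationContinuityZ3.Cruxes.AdditiveGluing.TieLine.FibreCount
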